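import Literature.NumberTheory.Weil1964.AdelicSecondDegreeCharacter
import Literature.NumberTheory.Automorphic.GodementJacquetThetaGrowth
import HarnessLib

/-!
# Majorants and continuity of the adelic theta kernel; the `WeilThetaDatum` of a majorised representation

Topic `NumberTheory/Weil1964`; namespace `Literature.NumberTheory.Weil1964`. KERNEL file: every declaration
below is a definition or a theorem proved in this file against Mathlib and the tree; there is no
`def … : Prop` record, no hypothesis is asserted and there is no `sorry`; every `[cite: …]` / `[folklore]` tag
is provenance for a kernel-checked statement.

Sequel to `AdelicThetaDistribution` (the theta distribution `Θ(Φ) = Σ_{ξ ∈ Fⁿ} Φ(ξ)` on `𝒮(𝔸_Fⁿ)`, the twists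
`d(g)Φ = Φ(· g)`, Poisson summation as a law of `Θ`, the stabiliser subgroup `thetaStabilizer`) and
`AdelicSecondDegreeCharacter` (Weil's operators `t(S)Φ = ψ_F(q_S) · Φ`). Weil [Weil1964, Chap. III n° 41,
Lemme 5 p. 192 and Théorème 6 p. 193] proves that for `Φ ∈ S(X_A)` the function `S ↦ Θ(SΦ) = Σ_{ξ ∈ X_k} (SΦ)(ξ)`
is continuous on the adelic metaplectic group by exhibiting, on every compact subset, ONE summable family
majorising all the terms ("il existe `Φ₀ ∈ S(X_A)` telle que … `|SΦ(x)| ≤ Φ₀(x)`"), and that it is invariant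
under the rational elements because these stabilise `Θ` (Poisson summation for the Weyl element, triviality of
`ψ` on `k` for `t(σ)`, `ξ ↦ ξγ` permuting `X_k` for `d(γ)`). This file
1. PROVES the majorant and the continuity for the part of the group that acts geometrically in the concrete
   adelic model, the Siegel parabolic generated by the twists `d(g)`, `g ∈ GL_n(𝔸_F)`, and the chirps `t(S)`,
   `S ∈ M_n(𝔸_F)`:
   * `exists_summable_majorant_twist_of_isCompact` — for `Φ ∈ 𝒮(𝔸_Fⁿ)` and a compact `C ⊆ GL_n(𝔸_F)` there
     is a summable `u : Fⁿ → ℝ` with `|Φ(ξ g)| ≤ u(ξ)` for all `ξ ∈ Fⁿ`, `g ∈ C` (archimedean decay of every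
     order + finite parts confined to a compact set; the tree's `norm_apply_vecMul_le_of_decay` and
     `summable_indicator_rpow_neg`, Godement–Jacquet LNM 260 §11);
   * `exists_summable_majorant_of_decay` — ONE summable majorant over `Fⁿ` for ALL functions obeying a fixed
     decay bound `M (1 + ‖x_∞‖)^{-k}` (`k > n [F:ℚ]`) and vanishing off a fixed compact set of finite parts (the
     shape in which a representation given by local formulas delivers Lemme 5: `HasThetaMajorants.of_decay`);
   * `continuous_thetaDist_twist` (`g ↦ Θ(Φ(· g))`), `continuous_thetaDist_chirp_twist`
     (`(g, S) ↦ Θ(t(S) d(g) Φ)`, jointly) — Théorème 6, conjunct 1, on the Siegel parabolic;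
2. isolates the GENERAL MECHANISM in the form in which a global Weil representation is consumed: for a map
   `ρ : G → (𝒮 → 𝒮)` on a topological space, `HasThetaMajorants ρ` (a `Prop`-valued structure bundling the
   two hypotheses "each term `g ↦ (ρ(g)Φ)(ξ)` is continuous" and "near every point the terms have a common
   summable majorant" — this is NOT a cited record: it is PROVED below for the twists and the chirps, and it
   is stable under continuous pull-back, `HasThetaMajorants.comp`) gives `Continuous (g ↦ Θ(ρ(g)Φ))`
   (`HasThetaMajorants.continuous_thetaDistLM`); for a homomorphism `ρ : G →* (End_ℂ 𝒮)ˣ` the pulled-back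
   datum `repWeilThetaDatum ρ Γ` (`act = ρ`, `rat = Γ`, `theta Φ g = Θ(ρ(g)Φ)`) satisfies `act_one`,
   `theta_act`, and **`thetaContinuousInvariant_repWeilThetaDatum`**: `HasThetaMajorants ρ` together with
   `ρ(Γ) ⊆ thetaStabilizer` yield Weil's `WeilThetaDatum.ThetaContinuousInvariant` (tree
   `Weil1964.ThetaDistribution`, the typing of Théorème 6) for it;
3. instantiates 2. twice: `hasThetaMajorants_twistUnit` / `thetaContinuousInvariant_twist` (group
   `GL_n(𝔸_F)`, rational subgroup `GL_n(F)`), `hasThetaMajorants_chirpUnit` / `thetaContinuousInvariant_chirp`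
   (group `M_n(𝔸_F)`, rational elements `M_n(F)`);
4. records the invariance side at MONOID level (`thetaStabilizerEnd`, no invertibility needed): the rational
   twists, the rational chirps AND the self-dual adelic Fourier transform (Poisson summation, F1) lie in it, so
   the submonoid they generate does (`closure_generators_le_thetaStabilizerEnd`) — Weil's three generator types
   of `Ps(X)_k` [Weil1964, Chap. I n° 13; Chap. III n° 41]; this is the exact obligation left to the constructor
   of a global Weil representation `ω`: express `ω(γ)`, `γ` rational, as such a product.

## References
* A. Weil, *Sur certains groupes d'opérateurs unitaires*, Acta Math. 111 (1964), Chap. III n° 39–41,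
  pp. 189–194 [Weil1964].
* R. Godement, H. Jacquet, *Zeta functions of simple algebras*, LNM 260 (1972), §11 [GodementJacquetLNM260].
-/

set_option autoImplicit false

noncomputable section

open scoped BigOperators NNReal Matrix Topology Classical
open NumberField NumberField.mixedEmbedding IsDedekindDomain Set Filter

namespace Literature.NumberTheory.Weil1964

open Literature.NumberTheory.Automorphic

/-! ### §1. A uniform summable majorant for the twists `Φ(ξ g)`, `g` in a compact set -/

section Majorant

variable (F : Type) [Field F] [NumberField F] {n : ℕ}

/-- **Uniform majorant of the twisted terms on a compact set** (the content of Weil's Lemme 5 for the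
operators `d(g)`, [Weil1964, Chap. III n° 41, Lemme 5 p. 192]; Godement–Jacquet, LNM 260 §11, Lemma 11.5):
for `Φ ∈ 𝒮(𝔸_Fⁿ)` and a compact `C ⊆ GL_n(𝔸_F)` there is a summable `u : Fⁿ → ℝ` with
`|Φ(ξ g)| ≤ u(ξ)` for every `ξ ∈ Fⁿ` and every `g ∈ C`.  Proof: `Φ` decays like `M (1 + ‖x_∞‖)^{-k}` for
every `k` and vanishes unless `x_f` lies in a compact set `C_f` (`exists_decay_of_mem_piSchwartzBruhat`); for
`g ∈ C` the finite parts `g_f` lie in a compact set, so `(ξ g)_f ∈ C_f` confines `ξ_f` to a compact `C'`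
(`exists_isCompact_vecFinitePart_mem`), and `‖ξ_∞‖ ≤ G₀ ‖(ξ g)_∞‖` with `G₀ = sup_C n² H_∞`
(`sum_norm_inv_arch_le_mul_archHeight`, continuity of `H_∞`); the majorant is
`M G₀^θ ‖ξ_∞‖^{-θ} 𝟙_{C'}(ξ_f)` (`norm_apply_vecMul_le_of_decay`), summable for `θ > n [F:ℚ]`
(`summable_indicator_rpow_neg`). [cite: Weil1964, Chap. III n° 41, Lemme 5 p. 192] -/
theorem exists_summable_majorant_twist_of_isCompact {Φ : (Fin n → AdeleRing (𝓞 F) F) → ℂ}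
    (hΦ : Φ ∈ piSchwartzBruhat F (Fin n)) {C : Set (GL (Fin n) (AdeleRing (𝓞 F) F))} (hC : IsCompact C) :
    ∃ u : (Fin n → F) → ℝ, Summable u ∧
      ∀ (ξ : Fin n → F), ∀ g ∈ C, ‖twist F g Φ (ratPt F (Fin n) ξ)‖ ≤ u ξ := by
  -- exponents and the decay data of `Φ`
  set θ : ℝ := (n : ℝ) * Module.finrank ℚ F + 1 with hθdef
  have hθ : (n : ℝ) * Module.finrank ℚ F < θ := lt_add_one _
  have hθ0 : 0 ≤ θ := le_trans (by positivity) hθ.le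
  set k : ℕ := ⌈θ⌉₊ with hk
  have hθk : θ ≤ k := Nat.le_ceil θ
  obtain ⟨M, hM0, Cf, hCfc, hd, hs⟩ := exists_decay_of_mem_piSchwartzBruhat hΦ k
  -- the finite parts of `C` lie in a compact set; the lattice condition
  have h𝒴 : IsCompact (GLn.sndHom n F '' C) := hC.image GLn.continuous_sndHom
  obtain ⟨C', hC'c, hC'⟩ := exists_isCompact_vecFinitePart_mem F (N := n) hCfc h𝒴
  -- a uniform bound for `∑ ‖(g⁻¹)_∞‖` on `C` through the archimedean height
  have hHc : Continuous fun g : GL (Fin n) (AdeleRing (𝓞 F) F) =>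
      (n : ℝ) ^ 2 * (GLn.archHeight n F g : ℝ) :=
    continuous_const.mul (NNReal.continuous_coe.comp (GLn.continuous_archHeight (n := n) (K := F)))
  obtain ⟨G₁, hG₁⟩ := hC.exists_bound_of_continuousOn hHc.continuousOn
  set G₀ : ℝ := max 1 G₁ with hG₀
  have hG₀0 : 0 < G₀ := one_pos.trans_le (le_max_left _ _)
  have hGL : ∀ g ∈ C, (∑ k, ∑ l, ‖(((g⁻¹ : GL (Fin n) (AdeleRing (𝓞 F) F)) :
      Matrix (Fin n) (Fin n) (AdeleRing (𝓞 F) F)).map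
        fun a => InfiniteAdeleRing.ringEquiv_mixedSpace F a.1) k l‖) ≤ G₀ := by
    intro g hg
    refine (sum_norm_inv_arch_le_mul_archHeight F g).trans ?_
    exact ((Real.le_norm_self _).trans (hG₁ g hg)).trans (le_max_right _ _)
  -- the majorant
  refine ⟨fun ξ => if ξ = 0 then M else
      C'.indicator (fun _ => M * G₀⁻¹ ^ (-θ) * ‖vecInfinitePart F n (ratVec F ξ)‖ ^ (-θ))
        (vecFinitePart F n (ratVec F ξ)),
    summable_indicator_rpow_neg (K := F) (N := n) hC'c hθ M (M * G₀⁻¹ ^ (-θ)), fun ξ g hg => ?_⟩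
  rw [twist_apply]
  beta_reduce
  by_cases hv : ξ = 0
  · rw [if_pos hv, hv, ratPt_zero, Matrix.zero_vecMul]
    refine (hd 0).trans ?_
    have h1 : (1 + ‖vecInfinitePart F n (0 : Fin n → AdeleRing (𝓞 F) F)‖) ^ (-(k : ℝ)) ≤ 1 :=
      Real.rpow_le_one_of_one_le_of_nonpos
        (by linarith [norm_nonneg (vecInfinitePart F n (0 : Fin n → AdeleRing (𝓞 F) F))])
        (neg_nonpos.2 (Nat.cast_nonneg k))
    calc M * (1 + ‖vecInfinitePart F n (0 : Fin n → AdeleRing (𝓞 F) F)‖) ^ (-(k : ℝ)) ≤ M * 1 :=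
          mul_le_mul_of_nonneg_left h1 hM0
      _ = M := mul_one M
  · rw [if_neg hv]
    exact norm_apply_vecMul_le_of_decay hM0 hd hs g (hC' g ⟨g, hg, rfl⟩) hG₀0 (hGL g hg) hθ0 hθk hv

/-- **Uniform decay data give a summable majorant** (the shape in which a global Weil representation delivers
Weil's Lemme 5: near `g₀`, all `ω(g)Φ` are bounded by ONE `M (1 + ‖x_∞‖)^{-k}` and vanish off ONE compact set of
finite parts).  For `M ≥ 0`, a compact `C_f ⊆ (𝔸_{F,f})ⁿ` and `n [F:ℚ] < θ ≤ k` there is a summable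
`u : Fⁿ → ℝ` majorising `ξ ↦ |Ψ(ξ)|` for EVERY `Ψ : 𝔸_Fⁿ → ℂ` with `|Ψ(x)| ≤ M (1 + ‖x_∞‖)^{-k}` and `Ψ(x) = 0`
unless `x_f ∈ C_f` (`norm_apply_vecMul_le_of_decay` at `L = 1`, `summable_indicator_rpow_neg`).
[cite: Weil1964, Chap. III n° 41, Lemme 5 p. 192] -/
theorem exists_summable_majorant_of_decay {M : ℝ} (hM0 : 0 ≤ M) (k : ℕ)
    {Cf : Set (Fin n → FiniteAdeleRing (𝓞 F) F)} (hCfc : IsCompact Cf)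
    {θ : ℝ} (hθ : (n : ℝ) * Module.finrank ℚ F < θ) (hθk : θ ≤ k) :
    ∃ u : (Fin n → F) → ℝ, Summable u ∧
      ∀ Ψ : (Fin n → AdeleRing (𝓞 F) F) → ℂ,
        (∀ x, ‖Ψ x‖ ≤ M * (1 + ‖vecInfinitePart F n x‖) ^ (-(k : ℝ))) →
        (∀ x, vecFinitePart F n x ∉ Cf → Ψ x = 0) →
          ∀ ξ : Fin n → F, ‖Ψ (ratPt F (Fin n) ξ)‖ ≤ u ξ := by
  have hθ0 : 0 ≤ θ := le_trans (by positivity) hθ.le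
  -- the constant `G₀ ≥ ∑ ‖(1⁻¹)_∞‖` for `L = 1`
  set G₀ : ℝ := max 1 (∑ k, ∑ l, ‖((((1 : GL (Fin n) (AdeleRing (𝓞 F) F))⁻¹ : GL (Fin n) (AdeleRing (𝓞 F) F)) :
      Matrix (Fin n) (Fin n) (AdeleRing (𝓞 F) F)).map
        fun a => InfiniteAdeleRing.ringEquiv_mixedSpace F a.1) k l‖) with hG₀
  have hG₀0 : 0 < G₀ := one_pos.trans_le (le_max_left _ _)
  refine ⟨fun ξ => if ξ = 0 then M else
      Cf.indicator (fun _ => M * G₀⁻¹ ^ (-θ) * ‖vecInfinitePart F n (ratVec F ξ)‖ ^ (-θ))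
        (vecFinitePart F n (ratVec F ξ)),
    summable_indicator_rpow_neg (K := F) (N := n) hCfc hθ M (M * G₀⁻¹ ^ (-θ)), fun Ψ hd hs ξ => ?_⟩
  beta_reduce
  by_cases hv : ξ = 0
  · rw [if_pos hv, hv, ratPt_zero]
    refine (hd 0).trans ?_
    have h1 : (1 + ‖vecInfinitePart F n (0 : Fin n → AdeleRing (𝓞 F) F)‖) ^ (-(k : ℝ)) ≤ 1 :=
      Real.rpow_le_one_of_one_le_of_nonpos
        (by linarith [norm_nonneg (vecInfinitePart F n (0 : Fin n → AdeleRing (𝓞 F) F))])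
        (neg_nonpos.2 (Nat.cast_nonneg k))
    calc M * (1 + ‖vecInfinitePart F n (0 : Fin n → AdeleRing (𝓞 F) F)‖) ^ (-(k : ℝ)) ≤ M * 1 :=
          mul_le_mul_of_nonneg_left h1 hM0
      _ = M := mul_one M
  · rw [if_neg hv]
    have h := norm_apply_vecMul_le_of_decay (C' := Cf) hM0 hd hs (1 : GL (Fin n) (AdeleRing (𝓞 F) F))
      (fun v hv' => by rwa [Matrix.GeneralLinearGroup.coe_one, Matrix.vecMul_one] at hv') hG₀0 (le_max_right _ _)
      hθ0 hθk hv
    rwa [Matrix.GeneralLinearGroup.coe_one, Matrix.vecMul_one] at h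

/-- The global (non-uniform) majorant for the chirps: `|t(S)Φ(ξ)| = |Φ(ξ)|`, summable over `ξ ∈ Fⁿ` for
`Φ ∈ 𝒮(𝔸_Fⁿ)`. [folklore] -/
theorem norm_chirp_ratPt_le {Φ : (Fin n → AdeleRing (𝓞 F) F) → ℂ}
    (S : Matrix (Fin n) (Fin n) (AdeleRing (𝓞 F) F)) (ξ : Fin n → F) :
    ‖chirp F S Φ (ratPt F (Fin n) ξ)‖ ≤ ‖Φ (ratPt F (Fin n) ξ)‖ :=
  (norm_chirp_apply S Φ _).le

end Majorant

/-! ### §2. Continuity of `g ↦ Θ(Φ(· g))` and `(g, S) ↦ Θ(t(S) Φ(· g))` -/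

section Continuity

variable (F : Type) [Field F] [NumberField F] {n : ℕ}

/-- Each term `g ↦ Φ(ξ g)` is continuous on `GL_n(𝔸_F)`. [folklore] -/
theorem continuous_twist_ratPt {Φ : (Fin n → AdeleRing (𝓞 F) F) → ℂ} (hΦ : Φ ∈ piSchwartzBruhat F (Fin n))
    (ξ : Fin n → F) :
    Continuous fun g : GL (Fin n) (AdeleRing (𝓞 F) F) => twist F g Φ (ratPt F (Fin n) ξ) :=
  (continuous_of_mem_piSchwartzBruhat hΦ).comp (continuous_const.matrix_vecMul Units.continuous_val)

/-- `S ↦ q_S(x) = ⟨x S, x⟩` is continuous on `M_n(𝔸_F)`. [folklore] -/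
theorem continuous_sdForm_left (x : Fin n → AdeleRing (𝓞 F) F) :
    Continuous fun S : Matrix (Fin n) (Fin n) (AdeleRing (𝓞 F) F) => sdForm F S x :=
  (continuous_const.matrix_vecMul continuous_id).dotProduct continuous_const

/-- `S ↦ ψ_F(q_S(x))` is continuous on `M_n(𝔸_F)`. [folklore] -/
theorem continuous_sdChar_left (x : Fin n → AdeleRing (𝓞 F) F) :
    Continuous fun S : Matrix (Fin n) (Fin n) (AdeleRing (𝓞 F) F) => sdChar F S x :=
  continuous_subtype_val.comp ((continuous_adeleAddChar F).comp (continuous_sdForm_left F x))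

/-- Each term `(g, S) ↦ (t(S) d(g) Φ)(ξ) = ψ_F(q_S(ξ)) Φ(ξ g)` is continuous. [folklore] -/
theorem continuous_chirp_twist_ratPt {Φ : (Fin n → AdeleRing (𝓞 F) F) → ℂ}
    (hΦ : Φ ∈ piSchwartzBruhat F (Fin n)) (ξ : Fin n → F) :
    Continuous fun p : GL (Fin n) (AdeleRing (𝓞 F) F) × Matrix (Fin n) (Fin n) (AdeleRing (𝓞 F) F) =>
      chirp F p.2 (twist F p.1 Φ) (ratPt F (Fin n) ξ) := by
  simp only [chirp_apply]
  exact ((continuous_sdChar_left F _).comp continuous_snd).mul ((continuous_twist_ratPt F hΦ ξ).comp continuous_fst)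

/-- **Théorème 6, conjunct 1, for the twists** [Weil1964, Chap. III n° 41, Thm 6 p. 193, with n° 39]:
for `Φ ∈ 𝒮(𝔸_Fⁿ)`, `g ↦ Θ(Φ(· g)) = Σ_{ξ ∈ Fⁿ} Φ(ξ g)` is continuous on `GL_n(𝔸_F)` (Weierstrass `M`-test
on compact sets, `exists_summable_majorant_twist_of_isCompact`). PROVED, not cited.
[cite: Weil1964, Chap. III n° 41, Thm 6 p. 193] -/
theorem continuous_thetaDist_twist {Φ : (Fin n → AdeleRing (𝓞 F) F) → ℂ} (hΦ : Φ ∈ piSchwartzBruhat F (Fin n)) :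
    Continuous fun g : GL (Fin n) (AdeleRing (𝓞 F) F) => thetaDist F (Fin n) (twist F g Φ) := by
  haveI : LocallyCompactSpace (GL (Fin n) (AdeleRing (𝓞 F) F)) :=
    AdelicGroupData.locallyCompactSpace_generalLinearGroup_adeleRing F (Fin n)
  show Continuous fun g : GL (Fin n) (AdeleRing (𝓞 F) F) => ∑' ξ : Fin n → F, twist F g Φ (ratPt F (Fin n) ξ)
  refine continuous_tsum_of_dominated_on_compacts (fun ξ => continuous_twist_ratPt F hΦ ξ) fun C hC => ?_
  obtain ⟨u, hu, hle⟩ := exists_summable_majorant_twist_of_isCompact F hΦ hC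
  exact ⟨u, hu, hle⟩

/-- **Théorème 6, conjunct 1, on the Siegel parabolic** [Weil1964, Chap. III n° 41, Thm 6 p. 193]: for
`Φ ∈ 𝒮(𝔸_Fⁿ)`, `(g, S) ↦ Θ(t(S) d(g) Φ) = Σ_{ξ ∈ Fⁿ} ψ_F(q_S(ξ)) Φ(ξ g)` is jointly continuous on
`GL_n(𝔸_F) × M_n(𝔸_F)` (the chirp has modulus one, so the majorant of the twists on a compact neighbourhood of
`g₀` serves on its product with all of `M_n(𝔸_F)`). PROVED, not cited. [cite: Weil1964, Chap. III n° 41, Thm 6 p. 193] -/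
theorem continuous_thetaDist_chirp_twist {Φ : (Fin n → AdeleRing (𝓞 F) F) → ℂ}
    (hΦ : Φ ∈ piSchwartzBruhat F (Fin n)) :
    Continuous fun p : GL (Fin n) (AdeleRing (𝓞 F) F) × Matrix (Fin n) (Fin n) (AdeleRing (𝓞 F) F) =>
      thetaDist F (Fin n) (chirp F p.2 (twist F p.1 Φ)) := by
  haveI : LocallyCompactSpace (GL (Fin n) (AdeleRing (𝓞 F) F)) :=
    AdelicGroupData.locallyCompactSpace_generalLinearGroup_adeleRing F (Fin n)
  show Continuous fun p : GL (Fin n) (AdeleRing (𝓞 F) F) × Matrix (Fin n) (Fin n) (AdeleRing (𝓞 F) F) =>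
    ∑' ξ : Fin n → F, chirp F p.2 (twist F p.1 Φ) (ratPt F (Fin n) ξ)
  refine continuous_tsum_of_locally_dominated (fun ξ => continuous_chirp_twist_ratPt F hΦ ξ) fun p₀ => ?_
  obtain ⟨C, hC, hCn⟩ := exists_compact_mem_nhds p₀.1
  obtain ⟨u, hu, hle⟩ := exists_summable_majorant_twist_of_isCompact F hΦ hC
  refine ⟨C ×ˢ univ, ?_, u, hu, fun ξ p hp => ?_⟩
  · exact prod_mem_nhds hCn univ_mem
  · rw [norm_chirp_apply]
    exact hle ξ p.1 (mem_prod.1 hp).1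

end Continuity

/-! ### §3. The general mechanism: majorised representations and the pulled-back `WeilThetaDatum` -/

section Generic

variable {F : Type} [Field F] [NumberField F] {ι : Type} [Fintype ι]
variable {G : Type*}

section Majorants

variable [TopologicalSpace G]

/-- **Theta majorants for a family of operators** `ρ : G → (𝒮(𝔸_F^ι) → 𝒮(𝔸_F^ι))` indexed by a topological
space: (i) each term `g ↦ (ρ(g)Φ)(ξ)`, `ξ ∈ F^ι`, is continuous; (ii) every point has a neighbourhood on
which all the terms are dominated by one summable family `u : F^ι → ℝ`.  This is the hypothesis of the
Weierstrass `M`-test in the form Weil verifies it [Weil1964, Chap. III n° 41, Lemme 5 p. 192: on a compact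
set, `|SΦ(x)| ≤ Φ₀(x)` with `Φ₀ ∈ S(X_A)`]; it is a bundle of two hypotheses PROVED below for the twists and the
chirps (`hasThetaMajorants_twistUnit`, `hasThetaMajorants_chirpUnit`), not a cited record. [folklore] -/
structure HasThetaMajorants (ρ : G → piSchwartzBruhat F ι → piSchwartzBruhat F ι) : Prop where
  /-- each term `g ↦ (ρ(g)Φ)(ξ)` is continuous -/
  continuous_eval : ∀ (Φ : piSchwartzBruhat F ι) (ξ : ι → F),
    Continuous fun g => ((ρ g Φ : piSchwartzBruhat F ι) : (ι → AdeleRing (𝓞 F) F) → ℂ) (ratPt F ι ξ)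
  /-- locally, one summable majorant for all the terms -/
  exists_majorant : ∀ (Φ : piSchwartzBruhat F ι) (g₀ : G), ∃ V ∈ 𝓝 g₀, ∃ u : (ι → F) → ℝ, Summable u ∧
    ∀ (ξ : ι → F), ∀ g ∈ V, ‖((ρ g Φ : piSchwartzBruhat F ι) : (ι → AdeleRing (𝓞 F) F) → ℂ) (ratPt F ι ξ)‖ ≤ u ξ

namespace HasThetaMajorants

variable {ρ : G → piSchwartzBruhat F ι → piSchwartzBruhat F ι}

/-- On a locally compact space it suffices to majorise on compact sets. [folklore] -/
theorem of_compacts [LocallyCompactSpace G]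
    (hc : ∀ (Φ : piSchwartzBruhat F ι) (ξ : ι → F),
      Continuous fun g => ((ρ g Φ : piSchwartzBruhat F ι) : (ι → AdeleRing (𝓞 F) F) → ℂ) (ratPt F ι ξ))
    (hb : ∀ (Φ : piSchwartzBruhat F ι) (C : Set G), IsCompact C → ∃ u : (ι → F) → ℝ, Summable u ∧
      ∀ (ξ : ι → F), ∀ g ∈ C, ‖((ρ g Φ : piSchwartzBruhat F ι) : (ι → AdeleRing (𝓞 F) F) → ℂ) (ratPt F ι ξ)‖ ≤ u ξ) :
    HasThetaMajorants ρ := by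
  refine ⟨hc, fun Φ g₀ => ?_⟩
  obtain ⟨C, hC, hCn⟩ := exists_compact_mem_nhds g₀
  obtain ⟨u, hu, hle⟩ := hb Φ C hC
  exact ⟨C, hCn, u, hu, hle⟩

/-- **`M`-test**: under `HasThetaMajorants ρ`, `g ↦ Θ(ρ(g)Φ)` is continuous for every `Φ ∈ 𝒮(𝔸_F^ι)`
(Théorème 6, conjunct 1, as a consequence of Lemme 5). [cite: Weil1964, Chap. III n° 41, Thm 6 p. 193] -/
theorem continuous_thetaDistLM (h : HasThetaMajorants ρ) (Φ : piSchwartzBruhat F ι) :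
    Continuous fun g => thetaDistLM F ι (ρ g Φ) := by
  show Continuous fun g => ∑' ξ : ι → F, ((ρ g Φ : piSchwartzBruhat F ι) : (ι → AdeleRing (𝓞 F) F) → ℂ) (ratPt F ι ξ)
  exact continuous_tsum_of_locally_dominated (fun ξ => h.continuous_eval Φ ξ) (h.exists_majorant Φ)

/-- Majorants pull back along continuous maps (e.g. along a continuous section of a dual pair into the
group carrying `ρ`). [folklore] -/
theorem comp (h : HasThetaMajorants ρ) {H : Type*} [TopologicalSpace H] {f : H → G} (hf : Continuous f) :
    HasThetaMajorants fun x => ρ (f x) := by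
  refine ⟨fun Φ ξ => (h.continuous_eval Φ ξ).comp hf, fun Φ x₀ => ?_⟩
  obtain ⟨V, hV, u, hu, hle⟩ := h.exists_majorant Φ (f x₀)
  exact ⟨f ⁻¹' V, hf.continuousAt.preimage_mem_nhds hV, u, hu, fun ξ x hx => hle ξ (f x) hx⟩

/-- **Uniform decay ⇒ theta majorants** (for `ι = Fin n`): if each term is continuous and every point `g₀` has
a neighbourhood on which all `ρ(g)Φ` obey ONE decay bound `M (1 + ‖x_∞‖)^{-k}`, `k > n [F:ℚ]`, and vanish off
ONE compact set of finite parts, then `ρ` has theta majorants (`exists_summable_majorant_of_decay`).  This is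
the form in which Weil's Lemme 5 [Weil1964, Chap. III n° 41, p. 192] is checked for a representation given by
local formulas. [cite: Weil1964, Chap. III n° 41, Lemme 5 p. 192] -/
theorem of_decay {n : ℕ} {ρ : G → piSchwartzBruhat F (Fin n) → piSchwartzBruhat F (Fin n)}
    (hc : ∀ (Φ : piSchwartzBruhat F (Fin n)) (ξ : Fin n → F),
      Continuous fun g => ((ρ g Φ : piSchwartzBruhat F (Fin n)) : (Fin n → AdeleRing (𝓞 F) F) → ℂ)
        (ratPt F (Fin n) ξ))
    (hd : ∀ (Φ : piSchwartzBruhat F (Fin n)) (g₀ : G), ∃ V ∈ 𝓝 g₀, ∃ (M : ℝ) (k : ℕ)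
      (Cf : Set (Fin n → FiniteAdeleRing (𝓞 F) F)), 0 ≤ M ∧ IsCompact Cf ∧
        (n : ℝ) * Module.finrank ℚ F < k ∧
        ∀ g ∈ V, (∀ x, ‖((ρ g Φ : piSchwartzBruhat F (Fin n)) : (Fin n → AdeleRing (𝓞 F) F) → ℂ) x‖ ≤
            M * (1 + ‖vecInfinitePart F n x‖) ^ (-(k : ℝ))) ∧
          (∀ x, vecFinitePart F n x ∉ Cf →
            ((ρ g Φ : piSchwartzBruhat F (Fin n)) : (Fin n → AdeleRing (𝓞 F) F) → ℂ) x = 0)) :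
    HasThetaMajorants ρ := by
  refine ⟨hc, fun Φ g₀ => ?_⟩
  obtain ⟨V, hV, M, k, Cf, hM0, hCfc, hk, hdec⟩ := hd Φ g₀
  obtain ⟨u, hu, hle⟩ := exists_summable_majorant_of_decay F hM0 k hCfc hk le_rfl
  exact ⟨V, hV, u, hu, fun ξ g hg => hle _ (hdec g hg).1 (hdec g hg).2 ξ⟩

end HasThetaMajorants

end Majorants

variable (F ι) in
/-- **The `WeilThetaDatum` of a representation.** For a homomorphism `ρ : G →* (End_ℂ 𝒮(𝔸_F^ι))ˣ` and a set
`Γ ⊆ G` of "rational" elements: `act g Φ = ρ(g)Φ`, `rat = Γ`, `theta Φ g = Θ(ρ(g)Φ) = Σ_{ξ ∈ F^ι} (ρ(g)Φ)(ξ)`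
— Weil's `Θ(S) = Σ_{ξ ∈ X_k} (SΦ)(ξ)` [Weil1964, Chap. III n° 41, p. 193] read through `ρ`; the pull-back of
the concrete datum `schwartzBruhatWeilThetaDatum` of F1 (`repWeilThetaDatum_theta_eq`).
[cite: Weil1964, Chap. III n° 41, Thm 6 p. 193] -/
def repWeilThetaDatum [Group G] (ρ : G →* (Module.End ℂ (piSchwartzBruhat F ι))ˣ) (Γ : Set G) :
    WeilThetaDatum G (piSchwartzBruhat F ι) where
  act g Φ := (ρ g : Module.End ℂ (piSchwartzBruhat F ι)) Φ
  rat := Γ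
  theta Φ g := thetaDistLM F ι ((ρ g : Module.End ℂ (piSchwartzBruhat F ι)) Φ)

section Rep

variable [Group G] (ρ : G →* (Module.End ℂ (piSchwartzBruhat F ι))ˣ) (Γ : Set G)

/-- Unfolding of `act`. [folklore] -/
@[simp] theorem repWeilThetaDatum_act (g : G) (Φ : piSchwartzBruhat F ι) :
    (repWeilThetaDatum F ι ρ Γ).act g Φ = (ρ g : Module.End ℂ (piSchwartzBruhat F ι)) Φ := rfl

/-- Unfolding of `rat`. [folklore] -/
@[simp] theorem repWeilThetaDatum_rat : (repWeilThetaDatum F ι ρ Γ).rat = Γ := rfl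

/-- Unfolding of `theta`. [folklore] -/
@[simp] theorem repWeilThetaDatum_theta (Φ : piSchwartzBruhat F ι) (g : G) :
    (repWeilThetaDatum F ι ρ Γ).theta Φ g =
      thetaDistLM F ι ((ρ g : Module.End ℂ (piSchwartzBruhat F ι)) Φ) := rfl

/-- `theta` is the concrete `theta` of F1 read through `ρ`. [folklore] -/
theorem repWeilThetaDatum_theta_eq (Φ : piSchwartzBruhat F ι) (g : G) :
    (repWeilThetaDatum F ι ρ Γ).theta Φ g = (schwartzBruhatWeilThetaDatum F ι).theta Φ (ρ g) := rfl

/-- As a series: `theta Φ g = Σ_{ξ ∈ F^ι} (ρ(g)Φ)(ξ)`. [cite: Weil1964, Chap. III n° 41, p. 193] -/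
theorem repWeilThetaDatum_theta_eq_tsum (Φ : piSchwartzBruhat F ι) (g : G) :
    (repWeilThetaDatum F ι ρ Γ).theta Φ g =
      ∑' ξ : ι → F, (((ρ g : Module.End ℂ (piSchwartzBruhat F ι)) Φ : piSchwartzBruhat F ι) :
        (ι → AdeleRing (𝓞 F) F) → ℂ) (ratPt F ι ξ) := rfl

/-- The unit acts trivially (the `act_one` field of the tree's `ThetaKernelDatum`). [folklore] -/
theorem repWeilThetaDatum_act_one (Φ : piSchwartzBruhat F ι) : (repWeilThetaDatum F ι ρ Γ).act 1 Φ = Φ := by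
  rw [repWeilThetaDatum_act, map_one, Units.val_one, Module.End.one_apply]

/-- `Θ_{S'Φ}(S) = Θ_Φ(S S')` (the `theta_act` field of the tree's `ThetaKernelDatum`). [folklore] -/
theorem repWeilThetaDatum_theta_act (Φ : piSchwartzBruhat F ι) (S S' : G) :
    (repWeilThetaDatum F ι ρ Γ).theta ((repWeilThetaDatum F ι ρ Γ).act S' Φ) S =
      (repWeilThetaDatum F ι ρ Γ).theta Φ (S * S') := by
  rw [repWeilThetaDatum_theta, repWeilThetaDatum_act, repWeilThetaDatum_theta, map_mul, Units.val_mul,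
    Module.End.mul_apply]

/-- `theta Φ 1 = Θ(Φ)`: the theta DISTRIBUTION is the value at the unit. [folklore] -/
theorem repWeilThetaDatum_theta_one (Φ : piSchwartzBruhat F ι) :
    (repWeilThetaDatum F ι ρ Γ).theta Φ 1 = thetaDistLM F ι Φ := by
  rw [repWeilThetaDatum_theta, map_one, Units.val_one, Module.End.one_apply]

/-- **Invariance** (Théorème 6, conjunct 2, mechanism): if `ρ(Γ)` stabilises `Θ` then `theta Φ (γ g) = theta Φ g`
for `γ ∈ Γ`. [cite: Weil1964, Chap. III n° 41, Thm 6 p. 193] -/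
theorem repWeilThetaDatum_theta_mul_left (hΓ : ∀ γ ∈ Γ, ρ γ ∈ thetaStabilizer F ι)
    (Φ : piSchwartzBruhat F ι) {γ : G} (hγ : γ ∈ Γ) (g : G) :
    (repWeilThetaDatum F ι ρ Γ).theta Φ (γ * g) = (repWeilThetaDatum F ι ρ Γ).theta Φ g := by
  rw [repWeilThetaDatum_theta, repWeilThetaDatum_theta, map_mul, Units.val_mul, Module.End.mul_apply]
  exact hΓ γ hγ _

/-- **Weil's Théorème 6 for a majorised representation with rational stabiliser**
[Weil1964, Chap. III n° 41, Thm 6 p. 193, as typed by the tree's `WeilThetaDatum.ThetaContinuousInvariant`]: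
if `ρ` has theta majorants and `ρ(Γ) ⊆ thetaStabilizer`, then for every `Φ` the function `g ↦ Θ(ρ(g)Φ)` is
continuous on `G` and invariant under left translation by `Γ`. [cite: Weil1964, Chap. III n° 41, Thm 6 p. 193] -/
theorem thetaContinuousInvariant_repWeilThetaDatum [TopologicalSpace G]
    (hρ : HasThetaMajorants fun g Φ => (ρ g : Module.End ℂ (piSchwartzBruhat F ι)) Φ)
    (hΓ : ∀ γ ∈ Γ, ρ γ ∈ thetaStabilizer F ι) :
    (repWeilThetaDatum F ι ρ Γ).ThetaContinuousInvariant :=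
  ⟨fun Φ => hρ.continuous_thetaDistLM Φ,
    fun Φ _γ hγ S => repWeilThetaDatum_theta_mul_left ρ Γ hΓ Φ hγ S⟩

end Rep

end Generic

/-! ### §4. Instances: the twists `d(g)`, `g ∈ GL_n(𝔸_F)`, and the chirps `t(S)`, `S ∈ M_n(𝔸_F)` -/

section Instances

variable (F : Type) [Field F] [NumberField F] (n : ℕ)

/-- **The twists have theta majorants** (`exists_summable_majorant_twist_of_isCompact`).
[cite: Weil1964, Chap. III n° 41, Lemme 5 p. 192] -/
theorem hasThetaMajorants_twistUnit :
    HasThetaMajorants fun (g : GL (Fin n) (AdeleRing (𝓞 F) F)) (Φ : piSchwartzBruhat F (Fin n)) =>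
      (twistUnit F n g : Module.End ℂ (piSchwartzBruhat F (Fin n))) Φ := by
  haveI : LocallyCompactSpace (GL (Fin n) (AdeleRing (𝓞 F) F)) :=
    AdelicGroupData.locallyCompactSpace_generalLinearGroup_adeleRing F (Fin n)
  refine HasThetaMajorants.of_compacts (fun Φ ξ => ?_) (fun Φ C hC => ?_)
  · simp only [coe_twistUnit, coe_twistLM]
    exact continuous_twist_ratPt F Φ.2 ξ
  · obtain ⟨u, hu, hle⟩ := exists_summable_majorant_twist_of_isCompact F Φ.2 hC
    refine ⟨u, hu, fun ξ g hg => ?_⟩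
    simp only [coe_twistUnit, coe_twistLM]
    exact hle ξ g hg

/-- **Théorème 6 for the twists**: on `GL_n(𝔸_F)` with rational elements `GL_n(F)`, `g ↦ Θ(Φ(· g))` is
continuous and left-`GL_n(F)`-invariant. PROVED. [cite: Weil1964, Chap. III n° 41, Thm 6 p. 193] -/
theorem thetaContinuousInvariant_twist :
    (repWeilThetaDatum F (Fin n) (twistUnit F n) (Set.range (ratGL F (n := n)))).ThetaContinuousInvariant := by
  refine thetaContinuousInvariant_repWeilThetaDatum _ _ (hasThetaMajorants_twistUnit F n) ?_
  rintro _ ⟨γ, rfl⟩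
  exact twistUnit_ratGL_mem_thetaStabilizer γ

/-- Each term `S ↦ (t(S)Φ)(ξ)` is continuous on `M_n(𝔸_F)` (as the group `Multiplicative (M_n(𝔸_F))`).
[folklore] -/
theorem continuous_chirpUnit_ratPt (Φ : piSchwartzBruhat F (Fin n)) (ξ : Fin n → F) :
    Continuous fun S : Multiplicative (Matrix (Fin n) (Fin n) (AdeleRing (𝓞 F) F)) =>
      (((chirpUnit F n S : Module.End ℂ (piSchwartzBruhat F (Fin n))) Φ : piSchwartzBruhat F (Fin n)) :
        (Fin n → AdeleRing (𝓞 F) F) → ℂ) (ratPt F (Fin n) ξ) := by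
  simp only [coe_chirpUnit, coe_chirpLM, chirp_apply]
  exact ((continuous_sdChar_left F (ratPt F (Fin n) ξ)).comp continuous_toAdd).mul continuous_const

/-- **The chirps have theta majorants**: `|t(S)Φ(ξ)| = |Φ(ξ)|`, one global summable majorant.
[cite: Weil1964, Chap. III n° 41, Lemme 5 p. 192] -/
theorem hasThetaMajorants_chirpUnit :
    HasThetaMajorants fun (S : Multiplicative (Matrix (Fin n) (Fin n) (AdeleRing (𝓞 F) F)))
      (Φ : piSchwartzBruhat F (Fin n)) => (chirpUnit F n S : Module.End ℂ (piSchwartzBruhat F (Fin n))) Φ := by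
  refine ⟨fun Φ ξ => continuous_chirpUnit_ratPt F n Φ ξ, fun Φ S₀ => ?_⟩
  refine ⟨univ, univ_mem, fun ξ => ‖(Φ : (Fin n → AdeleRing (𝓞 F) F) → ℂ) (ratPt F (Fin n) ξ)‖,
    summable_norm_ratPt Φ.2, fun ξ S _ => ?_⟩
  simp only [coe_chirpUnit, coe_chirpLM]
  exact norm_chirp_ratPt_le F S.toAdd ξ

/-- **Théorème 6 for the chirps**: on `M_n(𝔸_F)` with rational elements `M_n(F)`, `S ↦ Θ(t(S)Φ)` is continuous
and invariant under `S ↦ σ + S`, `σ ∈ M_n(F)`. PROVED. [cite: Weil1964, Chap. III n° 41, Thm 6 p. 193] -/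
theorem thetaContinuousInvariant_chirp :
    (repWeilThetaDatum F (Fin n) (chirpUnit F n)
      (Set.range fun σ : Matrix (Fin n) (Fin n) F => Multiplicative.ofAdd (ratMatrix F σ))).ThetaContinuousInvariant := by
  refine thetaContinuousInvariant_repWeilThetaDatum _ _ (hasThetaMajorants_chirpUnit F n) ?_
  rintro _ ⟨σ, rfl⟩
  exact chirpUnit_ratMatrix_mem_thetaStabilizer σ

end Instances

/-! ### §5. The stabiliser MONOID of `Θ`: twists, chirps and the Fourier transform together -/

section StabilizerMonoid

variable (F : Type) [Field F] [NumberField F] (ι : Type) [Fintype ι]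

/-- **The stabiliser submonoid of `Θ`** in `End_ℂ 𝒮(𝔸_F^ι)`: all endomorphisms `T` with `Θ(TΦ) = Θ(Φ)` for every
`Φ`.  The unit-level `thetaStabilizer` of F1 is its trace on `(End_ℂ 𝒮)ˣ` (`mem_thetaStabilizer_iff_coe_mem`);
the monoid version also holds the Fourier transform for a self-dual measure (Poisson summation,
`fourierLM_mem_thetaStabilizerEnd`), whose invertibility on `𝒮` is not needed for the invariance of `Θ`.
[cite: Weil1964, Chap. III n° 41, Thm 6 p. 193] -/
def thetaStabilizerEnd : Submonoid (Module.End ℂ (piSchwartzBruhat F ι)) where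
  carrier := {T | ∀ Φ : piSchwartzBruhat F ι, thetaDistLM F ι (T Φ) = thetaDistLM F ι Φ}
  one_mem' := fun _ => rfl
  mul_mem' := by
    intro S T hS hT Φ
    rw [Module.End.mul_apply, hS, hT]

variable {F ι}

/-- Membership in `thetaStabilizerEnd`. [folklore] -/
theorem mem_thetaStabilizerEnd_iff (T : Module.End ℂ (piSchwartzBruhat F ι)) :
    T ∈ thetaStabilizerEnd F ι ↔ ∀ Φ : piSchwartzBruhat F ι, thetaDistLM F ι (T Φ) = thetaDistLM F ι Φ :=
  Iff.rfl

/-- A unit stabilises `Θ` iff its underlying endomorphism does. [folklore] -/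
theorem mem_thetaStabilizer_iff_coe_mem (S : (Module.End ℂ (piSchwartzBruhat F ι))ˣ) :
    S ∈ thetaStabilizer F ι ↔ (S : Module.End ℂ (piSchwartzBruhat F ι)) ∈ thetaStabilizerEnd F ι :=
  Iff.rfl

/-- `thetaStabilizer` is the preimage of `thetaStabilizerEnd` under `(End 𝒮)ˣ → End 𝒮`. [folklore] -/
theorem thetaStabilizer_eq_comap :
    (thetaStabilizer F ι).toSubmonoid = (thetaStabilizerEnd F ι).comap (Units.coeHom (Module.End ℂ (piSchwartzBruhat F ι))) := by
  ext S
  rfl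

/-- **Poisson summation as membership**: for a Haar measure with `ν(D^ι) = 1` (self-dual normalisation) the
adelic Fourier transform `𝓕 ∈ End 𝒮(𝔸_F^ι)` stabilises `Θ` — the Weyl-element generator of Weil's `Ps(X)_k`
[Weil1964, Chap. III n° 41, proof of Thm 6 p. 193: "la formule de Poisson"]. [cite: Weil1964, Chap. III n° 41, Thm 6 p. 193] -/
theorem fourierLM_mem_thetaStabilizerEnd [MeasurableSpace (AdeleRing (𝓞 F) F)] [BorelSpace (AdeleRing (𝓞 F) F)]
    (ν : MeasureTheory.Measure (ι → AdeleRing (𝓞 F) F)) [ν.IsAddHaarMeasure]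
    (hν : ν (piFundamentalDomain F ι) = 1) :
    fourierLM F ι ν ∈ thetaStabilizerEnd F ι := fun Φ =>
  thetaDistLM_fourierLM_of_measure_eq_one Φ hν

/-- Rational twists stabilise `Θ` (monoid form of F1's `twistUnit_ratGL_mem_thetaStabilizer`).
[cite: Weil1964, Chap. III n° 41, Thm 6 p. 193] -/
theorem twistLM_ratGL_mem_thetaStabilizerEnd {n : ℕ} (γ : GL (Fin n) F) :
    twistLM F (ratGL F γ) ∈ thetaStabilizerEnd F (Fin n) := fun Φ =>
  thetaDistLM_twistLM_ratGL Φ γ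

/-- Rational chirps stabilise `Θ` (monoid form of F2's `chirpUnit_ratMatrix_mem_thetaStabilizer`).
[cite: Weil1964, Chap. III n° 41, Thm 6 p. 193] -/
theorem chirpLM_ratMatrix_mem_thetaStabilizerEnd {n : ℕ} (σ : Matrix (Fin n) (Fin n) F) :
    chirpLM F (ratMatrix F σ) ∈ thetaStabilizerEnd F (Fin n) := fun Φ =>
  thetaDistLM_chirpLM_ratMatrix σ Φ

/-- **The three generator types together**: the submonoid of `End 𝒮(𝔸_Fⁿ)` generated by the rational twists
`d(γ)`, `γ ∈ GL_n(F)`, the rational chirps `t(σ)`, `σ ∈ M_n(F)`, and the self-dual Fourier transform `𝓕`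
stabilises `Θ`.  Hence ANY operator that is a finite product of these — in particular the value of a global
Weil representation at a rational element, once so expressed — leaves `Θ` invariant: this is the exact
obligation handed to the constructor of `ω` (cf. Weil's proof of Thm 6 via the generators of `Ps(X)_k`,
[Weil1964, Chap. I n° 13 and Chap. III n° 41]). [cite: Weil1964, Chap. III n° 41, Thm 6 p. 193] -/
theorem closure_generators_le_thetaStabilizerEnd {n : ℕ} [MeasurableSpace (AdeleRing (𝓞 F) F)]
    [BorelSpace (AdeleRing (𝓞 F) F)] (ν : MeasureTheory.Measure (Fin n → AdeleRing (𝓞 F) F)) [ν.IsAddHaarMeasure]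
    (hν : ν (piFundamentalDomain F (Fin n)) = 1) :
    Submonoid.closure
        (Set.range (fun γ : GL (Fin n) F => twistLM F (ratGL F γ)) ∪
          Set.range (fun σ : Matrix (Fin n) (Fin n) F => chirpLM F (ratMatrix F σ)) ∪ {fourierLM F (Fin n) ν}) ≤
      thetaStabilizerEnd F (Fin n) := by
  refine Submonoid.closure_le.2 ?_
  rintro T ((⟨γ, rfl⟩ | ⟨σ, rfl⟩) | hT)
  · exact twistLM_ratGL_mem_thetaStabilizerEnd γ
  · exact chirpLM_ratMatrix_mem_thetaStabilizerEnd σ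
  · rw [Set.mem_singleton_iff.1 hT]
    exact fourierLM_mem_thetaStabilizerEnd ν hν

/-- Invariance of the pulled-back theta function from MONOID-level membership: if `ρ(γ) ∈ thetaStabilizerEnd`
(as an endomorphism) for `γ ∈ Γ`, then `theta Φ (γ g) = theta Φ g`. [cite: Weil1964, Chap. III n° 41, Thm 6 p. 193] -/
theorem repWeilThetaDatum_theta_mul_left_of_coe_mem {G : Type*} [Group G]
    (ρ : G →* (Module.End ℂ (piSchwartzBruhat F ι))ˣ) (Γ : Set G)
    (hΓ : ∀ γ ∈ Γ, (ρ γ : Module.End ℂ (piSchwartzBruhat F ι)) ∈ thetaStabilizerEnd F ι)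
    (Φ : piSchwartzBruhat F ι) {γ : G} (hγ : γ ∈ Γ) (g : G) :
    (repWeilThetaDatum F ι ρ Γ).theta Φ (γ * g) = (repWeilThetaDatum F ι ρ Γ).theta Φ g :=
  repWeilThetaDatum_theta_mul_left ρ Γ (fun γ hγ => (mem_thetaStabilizer_iff_coe_mem _).2 (hΓ γ hγ)) Φ hγ g

end StabilizerMonoid

end Literature.NumberTheory.Weil1964

end
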